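import Mathlib
import Summits.NavierStokesRegularity.NavierStokesRegularity.Theorems.TaoLadderRungTwoBreakBlowupRigidityOneClockedFrontLimitData
import Summits.NavierStokesRegularity.NavierStokesRegularity.Theorems.TaoLadderRungTwoBreakBlowupRigidityOnePeriodicPinnedSubunitary
import HarnessLib

/-!
# TYPE-I-FREE periodic closing: a CLOCKED FRONT (three-item front bundle, amplitude ratio `(1+ε₀)⁻¹ ≤ ν² < 1`) whose
  renormalisation is ASYMPTOTICALLY SHIFT-PERIODIC along its firing centres has a shift-periodic admissible surviving
  ω-limit, hence its table carries a non-trivial (S₁)-surviving admissible DSS wave — the conclusion of the crux K2(1)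
  `TaoLadderRungTwoBreak.BlowupRigidityOne` (stmt-NavierStokesRegularity-20206) WITHOUT type I (N-39)

Route-independent (no `Theses` import; the by-name leaf is `…PeriodicClockedFrontLinks`). MODEL lattice ODEs only (Tao
2016 §4 (4.8)/(4.12), §6.4); nothing here is a statement about the Navier–Stokes equations; NO item is closed
(`--supports stmt-NavierStokesRegularity-20206`). General `m`; DEF-FREE.

* `inv_le_dssMu_of_shiftPeriodic_of_shellBounds` — the lower survival half `(1+ε₀)⁻¹ ≤ μ_DSS` for a shift-periodic
  forward-(S₁)-surviving family needs only per-shell ALL-TIME bounds `e^{2x}‖W_n(x)‖² ≤ S_n` of the base shells (no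
  `UniformBound`), e.g. from a two-sided envelope;
* `periodicSurvivingEternalLimit_of_clockedFront` — clocked front (action ceiling, amplitude ceiling `Bν^j`, firing floor
  with two-sided clock, `Λ²ν² > 1`, weight threshold) + asymptotic `(q,T')`-periodicity of `W̃` relative to the firing
  centres ⇒ an admissible eternal limit, forward (S_a)-surviving, EXACTLY shift-periodic, with envelope `B²κ₂(Λ²ν²)^n`;
* `survivingDSSWave_of_periodicClockedFront` — at `a = 1` with `(1+ε₀)⁻¹ ≤ ν²` and `ν < 1` (`q ≥ 1`, `T' > 0`): a
  NON-TRIVIAL (S₁)-SURVIVING ADMISSIBLE DSS WAVE (sub-unitarity automatic: `e^{2T'} ≤ Λ²ν²`, so `μ_DSS ≤ ν² < 1`).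

HONEST LABEL: the bundle (front bundle (E2) + asymptotic periodicity (F3)) is OPEN and research-level; type I is NOT in
it; no stub, crux or summit is proved; rung 0.
-/

noncomputable section

-- the summit and its single sub-problem share the name (CONVENTIONS §1)
set_option linter.dupNamespace false

open Set Filter Topology MeasureTheory

namespace Summit.NavierStokesRegularity.NavierStokesRegularity.Theorems

namespace BlowupRigidityOne

open Literature.Analysis.FluidPDE Literature.Analysis.FluidPDE.TaoCascade

variable {m : ℕ}

/-- **Lower survival half from periodicity + per-shell all-time bounds.** If `W_{n+q}(σ) = W_n(σ - qT)` (`q ≥ 1`),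
every shell has an all-time bound `e^{2x}‖W_n(x)‖² ≤ S_n`, and `W` is forward (S₁)-surviving, then
`(1+ε₀)⁻¹ ≤ e^{2T}/(1+ε₀)^5`. [cite: Tao2016AveragedNS, §4 Lemma 4.1 (4.8)–(4.10) in self-similar variables, §6.4; cell vocabulary] -/
theorem inv_le_dssMu_of_shiftPeriodic_of_shellBounds {ε₀ T : ℝ} (hε : 0 < ε₀) {W : ℤ → ℝ → Em m} {q : ℕ}
    (hq : 0 < q) (hper : ∀ (n : ℤ) (σ : ℝ), W (n + q) σ = W n (σ - q * T))
    (hSb : ∀ n : ℤ, ∃ S : ℝ, ∀ x : ℝ, Real.exp (2 * x) * ‖W n x‖ ^ 2 ≤ S)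
    (hS : EternalSurvivingFwd 1 ε₀ W) : (1 + ε₀) ^ (-(1 : ℝ)) ≤ dssMu ε₀ T := by
  have hb : 0 < 1 + ε₀ := by linarith
  choose S hSS using hSb
  set Btot : ℝ := ∑ r : Fin q, |S (r.val : ℤ)| with hBtot
  have hBtot_ge : ∀ (r : Fin q) (y : ℝ), Real.exp (2 * y) * ‖W (r.val : ℤ) y‖ ^ 2 ≤ Btot := by
    intro r y
    refine ((hSS (r.val : ℤ) y).trans (le_abs_self _)).trans ?_
    rw [hBtot]
    exact Finset.single_le_sum (f := fun r' : Fin q => |S (r'.val : ℤ)|) (fun _ _ => abs_nonneg _)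
      (Finset.mem_univ r)
  have hBtot0 : 0 ≤ Btot := by rw [hBtot]; exact Finset.sum_nonneg fun _ _ => abs_nonneg _
  set θ : ℝ := physWeight 1 ε₀ * Real.exp (2 * T) with hθ
  have hpw : physWeight 1 ε₀ = (1 + ε₀) / (1 + ε₀) ^ 5 := by unfold physWeight; rw [Real.rpow_one]
  have hpw0 : 0 ≤ physWeight 1 ε₀ := by rw [hpw]; positivity
  have hpw1 : physWeight 1 ε₀ ≤ 1 := by
    rw [hpw, div_le_one (pow_pos hb 5)]
    exact le_self_pow₀ (by linarith) (by norm_num)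
  have hθ0 : 0 ≤ θ := by rw [hθ]; positivity
  by_contra hlt
  push Not at hlt
  have hθ1 : θ < 1 := by
    rw [Real.rpow_neg hb.le, Real.rpow_one] at hlt
    have e : θ = (1 + ε₀) * dssMu ε₀ T := by rw [hθ, hpw]; unfold dssMu; ring
    rw [e]
    calc (1 + ε₀) * dssMu ε₀ T < (1 + ε₀) * (1 + ε₀)⁻¹ := mul_lt_mul_of_pos_left hlt hb
      _ = 1 := mul_inv_cancel₀ hb.ne'
  obtain ⟨c, hc, H⟩ := hS
  obtain ⟨K, hK⟩ := exists_pow_lt_of_lt_one (div_pos hc (by linarith : (0 : ℝ) < Btot + 1)) hθ1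
  obtain ⟨n, hn, σ, -, hle⟩ := H (q * K)
  set r : ℕ := n % q with hr
  set k : ℕ := n / q with hk
  have hnrk : n = r + q * k := by rw [hr, hk]; exact (Nat.mod_add_div n q).symm
  have hkK : K ≤ q * k := by
    have h1 : K ≤ k := by
      have := Nat.div_le_div_right (c := q) hn
      rwa [Nat.mul_div_cancel_left K hq] at this
    calc K = 1 * K := (one_mul K).symm
      _ ≤ q * k := Nat.mul_le_mul hq h1
  have hred : W (n : ℤ) σ = W (r : ℤ) (σ - (k : ℝ) * (q : ℝ) * T) := shiftPeriodic_reduce hper n σ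
  set y : ℝ := σ - (k : ℝ) * (q : ℝ) * T with hy
  have hexp : Real.exp (2 * σ) = Real.exp (2 * T) ^ (q * k) * Real.exp (2 * y) := by
    rw [← Real.exp_nat_mul, ← Real.exp_add, hy]; push_cast; ring_nf
  have hmain : physWeight 1 ε₀ ^ n * (Real.exp (2 * σ) * ‖W (n : ℤ) σ‖ ^ 2)
      = physWeight 1 ε₀ ^ r * θ ^ (q * k) * (Real.exp (2 * y) * ‖W (r : ℤ) y‖ ^ 2) := by
    rw [hred, hexp, hnrk, pow_add, hθ, mul_pow]; ring
  have hrlt : r < q := by rw [hr]; exact Nat.mod_lt n hq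
  have h1 : physWeight 1 ε₀ ^ r ≤ 1 := pow_le_one₀ hpw0 hpw1
  have h2 : θ ^ (q * k) ≤ θ ^ K := pow_le_pow_of_le_one hθ0 hθ1.le hkK
  have h3 : Real.exp (2 * y) * ‖W (r : ℤ) y‖ ^ 2 ≤ Btot := hBtot_ge ⟨r, hrlt⟩ y
  have h4 : c ≤ 1 * θ ^ K * Btot := by
    calc c ≤ physWeight 1 ε₀ ^ n * (Real.exp (2 * σ) * ‖W (n : ℤ) σ‖ ^ 2) := hle
      _ = physWeight 1 ε₀ ^ r * θ ^ (q * k) * (Real.exp (2 * y) * ‖W (r : ℤ) y‖ ^ 2) := hmain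
      _ ≤ 1 * θ ^ K * Btot := by
          apply mul_le_mul (mul_le_mul h1 h2 (by positivity) zero_le_one) h3 (by positivity) (by positivity)
  have h5 : θ ^ K * Btot < c := by
    have h6 : θ ^ K * Btot ≤ c / (Btot + 1) * Btot := mul_le_mul_of_nonneg_right hK.le hBtot0
    have h7 : c / (Btot + 1) * Btot < c := by
      rw [div_mul_eq_mul_div, div_lt_iff₀ (by linarith : (0 : ℝ) < Btot + 1)]
      nlinarith
    linarith
  linarith

/-- **PERIODIC SURVIVING ETERNAL ω-LIMIT OF AN ASYMPTOTICALLY SHIFT-PERIODIC CLOCKED FRONT (general `a`, NO type I).**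
Hypotheses of `clockedFront_limitData` plus asymptotic `(q,T')`-periodicity of the renormalisation `W̃` relative to the
firing centres `s_j = -log(T - τ_j)`: `W̃_{n+q+j}(σ + qT' + s_j) - W̃_{n+j}(σ + s_j) → 0` for every `n, σ`. Conclusion: an
admissible eternal solution, forward (S_a)-surviving, EXACTLY shift-periodic `W∞_{n+q}(σ) = W∞_n(σ - qT')`, with the
two-sided envelope `e^{2σ}‖W∞_n(σ)‖² ≤ B²κ₂(Λ²ν²)^n`.
[cite: Tao2016AveragedNS, §4 Thm. 4.2 (statement shape), (4.8)–(4.10), §6.4; KochNadirashviliSereginSverak2009, Thm 1.1 ff.; cell vocabulary (`IsEternal`, `EternalSurvivingFwd`)] -/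
theorem periodicSurvivingEternalLimit_of_clockedFront {ε₀ T A B ν cf κ₁ κ₂ a T' : ℝ} (hε : 0 < ε₀) (hT : 0 < T)
    {α : Fin m → Fin m → Fin m → ℤ × ℤ × ℤ → ℝ}
    {X : Fin m → ℤ → ℝ → ℝ} (hC1 : ∀ i n, ContDiffOn ℝ 1 (X i n) (Set.Ico 0 T))
    (hmot : ∀ i n t, 0 ≤ t → t < T → derivWithin (X i n) (Set.Ici 0) t = quadTerm ε₀ α X i n t)
    {W : ℤ → ℝ → Em m}
    (hW : ∀ n σ, W n σ = (bigLam ε₀ ^ n * Real.exp (-σ)) • shellVec X n (T - Real.exp (-σ)))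
    (hact : ∀ k : ℤ, IntegrableOn (fun t => ‖shellVec X k t‖) (Ico 0 T) ∧
      bigLam ε₀ ^ k * (∫ t in Ico 0 T, ‖shellVec X k t‖) ≤ A)
    (hν : 0 < ν) (hamp : ∀ (j : ℤ) (t : ℝ), 0 ≤ t → t < T → ‖shellVec X j t‖ ≤ B * ν ^ j)
    {τ : ℕ → ℝ} (hτ : ∀ k : ℕ, 0 ≤ τ k ∧ τ k < T)
    (hfloor : ∀ k : ℕ, cf * (ν ^ 2) ^ k ≤ ‖shellVec X (k : ℤ) (τ k)‖ ^ 2)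
    (hclock₁ : ∀ k : ℕ, κ₁ ≤ (bigLam ε₀ ^ 2 * ν ^ 2) ^ k * (T - τ k) ^ 2)
    (hclock₂ : ∀ k : ℕ, (bigLam ε₀ ^ 2 * ν ^ 2) ^ k * (T - τ k) ^ 2 ≤ κ₂)
    (hcf : 0 < cf) (hκ₁ : 0 < κ₁) (hκ₂ : 0 < κ₂) (hq1 : 1 < bigLam ε₀ ^ 2 * ν ^ 2)
    (hpw : 1 ≤ physWeight a ε₀ * (bigLam ε₀ ^ 2 * ν ^ 2)) {q : ℕ}
    (hasym : ∀ (n : ℤ) (σ : ℝ), Tendsto (fun j : ℕ =>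
      W (n + q + (j : ℤ)) (σ + q * T' + -Real.log (T - τ j)) - W (n + (j : ℤ)) (σ + -Real.log (T - τ j)))
        atTop (𝓝 0)) :
    ∃ Wlim : ℤ → ℝ → Em m, IsEternal ε₀ α Wlim ∧ EternalSurvivingFwd a ε₀ Wlim ∧
      (∀ (n : ℤ) (σ : ℝ), Wlim (n + q) σ = Wlim n (σ - q * T')) ∧
      (∀ (n : ℤ) (σ : ℝ), Real.exp (2 * σ) * ‖Wlim n σ‖ ^ 2 ≤ B ^ 2 * κ₂ * (bigLam ε₀ ^ 2 * ν ^ 2) ^ n) := by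
  obtain ⟨φ, hφ, Wlim, hconv, hEt, hS, henv⟩ := clockedFront_limitData hε hT hC1 hmot hW hact hν hamp hτ hfloor hclock₁
    hclock₂ hcf hκ₁ hκ₂ hq1 hpw
  have hper : ∀ (n : ℤ) (u : ℝ), Wlim (n + q) (u + q * T') = Wlim n u := by
    intro n u
    have h1 : Tendsto (fun j => W (n + q + ((φ j : ℕ) : ℤ)) (u + q * T' + -Real.log (T - τ (φ j)))) atTop
        (𝓝 (Wlim (n + q) (u + q * T'))) := by
      have h := hconv (n + q) (fun _ => u + q * T') (u + q * T') tendsto_const_nhds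
      refine h.congr fun j => ?_
      simp only [add_assoc]
    have h2 : Tendsto (fun j => W (n + ((φ j : ℕ) : ℤ)) (u + -Real.log (T - τ (φ j)))) atTop (𝓝 (Wlim n u)) :=
      hconv n (fun _ => u) u tendsto_const_nhds
    have h3 := (hasym n u).comp hφ.tendsto_atTop
    exact sub_eq_zero.1 (tendsto_nhds_unique (h1.sub h2) h3)
  refine ⟨Wlim, hEt, hS, fun n σ => ?_, henv⟩
  have h := hper n (σ - q * T')
  rw [sub_add_cancel] at h
  exact h

/-- **THE CRUX'S CONCLUSION FOR ONE TABLE, TYPE-I-FREE (`a = 1`).** A clocked front of `α` (action ceiling, amplitude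
ceiling `B ν^j` with `(1+ε₀)⁻¹ ≤ ν²` and `ν < 1`, firing floor `c_f(ν²)^k` with two-sided clock) whose renormalisation is
asymptotically `(q,T')`-periodic along its firing centres (`q ≥ 1`, `T' > 0`) yields a NON-TRIVIAL (S₁)-SURVIVING
ADMISSIBLE DSS WAVE of `α`. Sub-unitarity of the wave is automatic (`e^{2T'} ≤ Λ²ν²`, so `μ_DSS ≤ ν² < 1`).
[cite: Tao2016AveragedNS, §4 Thm. 4.2, (4.8)–(4.10), §6.4; KochNadirashviliSereginSverak2009, Thm 1.1 ff.; cell vocabulary (`IsDSSWave`, `Surviving`)] -/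
theorem survivingDSSWave_of_periodicClockedFront {ε₀ T A B ν cf κ₁ κ₂ T' : ℝ} (hε : 0 < ε₀) (hT : 0 < T)
    {α : Fin m → Fin m → Fin m → ℤ × ℤ × ℤ → ℝ}
    {X : Fin m → ℤ → ℝ → ℝ} (hC1 : ∀ i n, ContDiffOn ℝ 1 (X i n) (Set.Ico 0 T))
    (hmot : ∀ i n t, 0 ≤ t → t < T → derivWithin (X i n) (Set.Ici 0) t = quadTerm ε₀ α X i n t)
    {W : ℤ → ℝ → Em m}
    (hW : ∀ n σ, W n σ = (bigLam ε₀ ^ n * Real.exp (-σ)) • shellVec X n (T - Real.exp (-σ)))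
    (hact : ∀ k : ℤ, IntegrableOn (fun t => ‖shellVec X k t‖) (Ico 0 T) ∧
      bigLam ε₀ ^ k * (∫ t in Ico 0 T, ‖shellVec X k t‖) ≤ A)
    (hν : 0 < ν) (hν1 : (1 + ε₀)⁻¹ ≤ ν ^ 2) (hνlt : ν < 1)
    (hamp : ∀ (j : ℤ) (t : ℝ), 0 ≤ t → t < T → ‖shellVec X j t‖ ≤ B * ν ^ j)
    {τ : ℕ → ℝ} (hτ : ∀ k : ℕ, 0 ≤ τ k ∧ τ k < T)
    (hfloor : ∀ k : ℕ, cf * (ν ^ 2) ^ k ≤ ‖shellVec X (k : ℤ) (τ k)‖ ^ 2)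
    (hclock₁ : ∀ k : ℕ, κ₁ ≤ (bigLam ε₀ ^ 2 * ν ^ 2) ^ k * (T - τ k) ^ 2)
    (hclock₂ : ∀ k : ℕ, (bigLam ε₀ ^ 2 * ν ^ 2) ^ k * (T - τ k) ^ 2 ≤ κ₂)
    (hcf : 0 < cf) (hκ₁ : 0 < κ₁) (hκ₂ : 0 < κ₂) {q : ℕ} (hq : 0 < q) (hT' : 0 < T')
    (hasym : ∀ (n : ℤ) (σ : ℝ), Tendsto (fun j : ℕ =>
      W (n + q + (j : ℤ)) (σ + q * T' + -Real.log (T - τ j)) - W (n + (j : ℤ)) (σ + -Real.log (T - τ j)))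
        atTop (𝓝 0)) :
    ∃ (q : ℕ) (π : Equiv.Perm (Fin q)) (T : ℝ) (Φ : Fin q → ℝ → Em m),
      IsDSSWave ε₀ α π T Φ ∧ Surviving 1 ε₀ T ∧ ∃ r x, Φ r x ≠ 0 := by
  have hb : (0 : ℝ) < 1 + ε₀ := by linarith
  have hΛ : 0 < bigLam ε₀ := bigLam_pos (by linarith)
  have hpw : 1 ≤ physWeight 1 ε₀ * (bigLam ε₀ ^ 2 * ν ^ 2) :=
    physWeight_mul_ge_one_of_surviving hε (a := 1) (by rwa [Real.rpow_neg_one])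
  have hq1 : 1 < bigLam ε₀ ^ 2 * ν ^ 2 := by
    rw [bigLam_sq hε]
    have h4 : (1 : ℝ) < (1 + ε₀) ^ 4 := one_lt_pow₀ (by linarith) (by norm_num)
    have h5 : (1 + ε₀) ^ 4 ≤ (1 + ε₀) ^ 5 * ν ^ 2 := by
      calc (1 + ε₀) ^ 4 = (1 + ε₀) ^ 5 * (1 + ε₀)⁻¹ := by field_simp
        _ ≤ (1 + ε₀) ^ 5 * ν ^ 2 := mul_le_mul_of_nonneg_left hν1 (pow_pos hb 5).le
    exact lt_of_lt_of_le h4 h5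
  obtain ⟨Wlim, hEt, hS, hper, henv⟩ := periodicSurvivingEternalLimit_of_clockedFront hε hT hC1 hmot hW hact hν hamp hτ
    hfloor hclock₁ hclock₂ hcf hκ₁ hκ₂ hq1 hpw hasym
  -- sub-unitarity: `e^{2T'} ≤ Λ²ν²`, so `μ_DSS ≤ ν² < 1`
  obtain ⟨n₀, σ₀, hne⟩ := exists_ne_zero_of_eternalSurvivingFwd hS
  have hθ : 0 < bigLam ε₀ ^ 2 * ν ^ 2 := by positivity
  have hdelay := exp_delay_le_of_envelope_shiftPeriodic hq hper hθ henv hne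
  have hμlt : dssMu ε₀ T' < 1 := by
    unfold dssMu
    rw [← bigLam_sq hε, div_lt_one (pow_pos hΛ 2)]
    have hν2 : ν ^ 2 < 1 := pow_lt_one₀ hν.le hνlt two_ne_zero
    calc Real.exp (2 * T') ≤ bigLam ε₀ ^ 2 * ν ^ 2 := hdelay
      _ < bigLam ε₀ ^ 2 * 1 := mul_lt_mul_of_pos_left hν2 (pow_pos hΛ 2)
      _ = bigLam ε₀ ^ 2 := mul_one _
  -- lower half from periodicity + envelope bounds + survival
  have hlow : (1 + ε₀) ^ (-(1 : ℝ)) ≤ dssMu ε₀ T' :=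
    inv_le_dssMu_of_shiftPeriodic_of_shellBounds hε hq hper
      (fun n => ⟨B ^ 2 * κ₂ * (bigLam ε₀ ^ 2 * ν ^ 2) ^ n, fun x => henv n x⟩) hS
  exact survivingDSSWave_of_shiftPeriodic hEt hq hT' hper ⟨hlow, hμlt⟩ hS

end BlowupRigidityOne

end Summit.NavierStokesRegularity.NavierStokesRegularity.Theorems

end
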